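import Summits.ResolutionOfSingularities.ResolutionOfSingularities.Theorems.FrobeniusClosingPatchingRelPerfectDepthSNCPointwise
import Literature.AlgebraicGeometry.Resolution.MonomializationAlongValuation
import Literature.AlgebraicGeometry.Resolution.MarkedIdealsLemmas
import HarnessLib

/-!
# Crux `PatchingRelPerfect` (stmt-ResolutionOfSingularities-16161), chain W5.2 — TargetsF5 (JR):
# at a JOINT centre point the host has multiplicity ONE along the centre

[OURS · L1 W5.2 · rung tool] Replaces the role of NO printed item; NOT a statement of the manuscript under review; fact-free.
In TargetsF5 of record (JR, v5.1) the E-side step carries the reduced host `D` with a multiplicity `m` along the centre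
(`D ≤ C ^ m`), and at JOINT points `z` the clause `JointStepAtJR D C ℬ 𝒟 z` makes the host a member of a regular system of
parameters at `z` containing generators of `C_z` (`DepthSNC.SNCWithAt (D :: …) C z` with `D_z ≤ C_z`). Consequence proved
here: `m ≤ 1` (a minimal generator of `𝔪_z` is not in `𝔪_z²`, Nakayama — tree `not_mem_sq_of_span_eq_maximalIdeal`), so at a
step with a JOINT point the X-side format (res-D-pv-052) steps the host by the weight-ONE controlled transform, which at such
points is the strict transform (res-D-pv-026's brick `IsBlowup.strictTransformIdeal_eq_controlledTransform`) — the stalk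
hypothesis of `DepthSNC.pocketSNC_step_host` (res-D-pv-009, …DepthPocketInvariantHost).

* `SNCWithAt.not_stalkIdeal_le_sq` — a member through `x` of a family snc at `x` has stalk `⊄ 𝔪_x²`;
* `SNCWithAt.le_one_of_stalkIdeal_le_pow` — if its stalk lies in `𝔪_x^m` then `m ≤ 1`;
* `SNCWithAt.le_one_of_le_centre_pow` — if `D ≤ C^m` (or stalkwise) for a member `D` through a centre point then `m ≤ 1`.

## References
* H. Matsumura, *Commutative Ring Theory* (1986), Thm. 2.3 (Nakayama), §14. [Matsumura1987]
* E. Bierstone, D. Grigoriev, P. Milman, J. Włodarczyk, arXiv:1206.3090, Def. 3.1.3 (2), §3.2 Lemma 3.2.1. [BierstoneGrigorievMilmanWlodarczyk2011]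
-/

-- `Summit.<Summit>.<Sub>.Theorems` with `Sub = Summit` (single-conjunct summit, D-0017)
set_option linter.dupNamespace false

noncomputable section

open CategoryTheory CategoryTheory.Limits AlgebraicGeometry TopologicalSpace IsLocalRing
open Literature.AlgebraicGeometry.Resolution

namespace Summit.ResolutionOfSingularities.ResolutionOfSingularities.Theorems

universe u

namespace DepthSNC

variable {X : Scheme.{u}} {E : List X.IdealSheafData} {C : X.IdealSheafData} {x : X}

/-- [OURS · L1 W5.2] **A member through `x` of a family that is snc at `x` has stalk not contained in `𝔪_x²`** (its stalk is
generated by a member of a minimal generating set of `𝔪_x`; Nakayama). [cite: Matsumura1987, Thm. 2.3] -/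
theorem SNCWithAt.not_stalkIdeal_le_sq (h : SNCWithAt E C x) {D : X.IdealSheafData} (hD : D ∈ E) (hxD : x ∈ D.support) :
    ¬ stalkIdeal D x ≤ maximalIdeal (X.presheaf.stalk x) ^ 2 := by
  classical
  obtain ⟨hreg, d, v, hd, hv, ⟨ι, -, hιD⟩, -⟩ := h
  haveI := hreg
  intro hle
  have hgen : stalkIdeal D x = Ideal.span {v (ι ⟨D, hD, hxD⟩)} := hιD ⟨D, hD, hxD⟩
  have hmem : v (ι ⟨D, hD, hxD⟩) ∈ maximalIdeal (X.presheaf.stalk x) ^ 2 :=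
    hle (hgen ▸ Ideal.mem_span_singleton_self _)
  refine not_mem_sq_of_span_eq_maximalIdeal (Finset.univ.image v) ?_ ?_
    (Finset.mem_image_of_mem _ (Finset.mem_univ _)) hmem
  · rw [Finset.coe_image, Finset.coe_univ, Set.image_univ, hv]
  · rw [hd]
    exact Finset.card_image_le.trans (by simp)

/-- [OURS · L1 W5.2] **If the stalk of a member through `x` lies in `𝔪_x^m`, then `m ≤ 1`.** [cite: Matsumura1987, Thm. 2.3] -/
theorem SNCWithAt.le_one_of_stalkIdeal_le_pow (h : SNCWithAt E C x) {D : X.IdealSheafData} (hD : D ∈ E)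
    (hxD : x ∈ D.support) {m : ℕ} (hm : stalkIdeal D x ≤ maximalIdeal (X.presheaf.stalk x) ^ m) : m ≤ 1 := by
  by_contra hlt
  have h2 : 2 ≤ m := by omega
  exact h.not_stalkIdeal_le_sq hD hxD (hm.trans (Ideal.pow_le_pow_right h2))

/-- [OURS · L1 W5.2] **At a JOINT centre point the host has multiplicity at most one along the centre**: if a member `D`
of a family snc at the centre point `x ∈ V(C)` has `D_x ≤ C_x ^ m`, then `m ≤ 1` (TargetsF5 JR: `JointStepAtJR D C ℬ 𝒟 z`
with the step datum `D ≤ C ^ m`). [cite: BierstoneGrigorievMilmanWlodarczyk2011, §3.2 Lemma 3.2.1] -/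
theorem SNCWithAt.le_one_of_le_centre_pow (h : SNCWithAt E C x) {D : X.IdealSheafData} (hD : D ∈ E) (hxD : x ∈ D.support)
    (hxC : x ∈ C.support) {m : ℕ} (hm : stalkIdeal D x ≤ stalkIdeal C x ^ m) : m ≤ 1 :=
  h.le_one_of_stalkIdeal_le_pow hD hxD
    (hm.trans (Ideal.pow_right_mono ((mem_support_iff_stalkIdeal_le C x).mp hxC) m))

/-- The global form: `D ≤ C ^ m` for a member `D` through a centre point of a family snc there forces `m ≤ 1`.
[cite: BierstoneGrigorievMilmanWlodarczyk2011, §3.2 Lemma 3.2.1] -/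
theorem SNCWithAt.le_one_of_le_pow (h : SNCWithAt E C x) {D : X.IdealSheafData} (hD : D ∈ E) (hxD : x ∈ D.support)
    (hxC : x ∈ C.support) {m : ℕ} (hm : D ≤ C ^ m) : m ≤ 1 := by
  refine h.le_one_of_le_centre_pow hD hxD hxC ?_
  rw [← stalkIdeal_pow]
  exact stalkIdeal_mono hm x

end DepthSNC

end Summit.ResolutionOfSingularities.ResolutionOfSingularities.Theorems

end
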